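import Summits.QuantumFields.YangMills.Theorems.OneCertifiedCubeCrossoverCertificateFrozenFreezing
import Summits.QuantumFields.YangMills.Theorems.OneCertifiedCubeCrossoverCertificateUVLeg

/-!
# `CrossoverCertificate` — negative lemma modulo `FrozenSU2Limit`
# (the certificate fails along every FROZEN weak-coupling scheme: `β_k → ∞` too fast against `a_k`)

Crux `stmt-QuantumFields-16125` (`Summit.QuantumFields.YangMills.Theses.OneCertifiedCube.CrossoverCertificate`): for EVERY
compact simple `G`, `r`, EVERY scheme `sch` with `β_k → ∞` and EVERY `T` with `IsYangMillsFor r sch T ∧ IsNontrivial ∧ IsNonGaussian`,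
at one physical scale `(ℓ, n)` the one-cube TV influence `Θ(r.ρ, β_k, ⌈ℓ/a_k⌉, n)` is eventually `≤ ε < 1/M(n) ≤ 1/1776`.

**What is proved here (kernel-checked, T-free input):** the frozen-coupling theorem
`exists_beta0_half_le_influence` (`…FrozenFreezing.lean`): for `G = SU(2)` in the fundamental representation and every
cell geometry `b ≥ 2`, `n ≥ 1` there is `β₀(b, n)` with `Θ(ρ, β, b, n) ≥ 1/2` for ALL `β ≥ β₀(b, n)` (centre-twisted boundary
condition + freezing of the Wilson kernels on action minimisers).  Packaging the thresholds into a canonical monotone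
ENVELOPE `frozenEnvelope m ≥ β₀(b, n)` (`b, n ≤ m`; `frozenThreshold`, `half_le_influence_of_frozenEnvelope_le`), a scheme is
FROZEN when `β_k ≥ frozenEnvelope ⌈k / a_k⌉` eventually; along a frozen scheme `Θ(ρ, β_k, ⌈ℓ/a_k⌉, n) ≥ 1/2` eventually for
EVERY `(ℓ, n)` (`eventually_half_le_influence_of_isFrozen`), so no certificate exists at any scale.

**The negative lemma** `crossoverCertificate_false_of_frozenSU2Limit : FrozenSU2Limit → ¬ CrossoverCertificate`, with
`H = FrozenSU2Limit`: `SU(2)` is admissible (`IsCompactSimpleLieGroup`, i.e. the tree's named fact on the simplicity of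
`SU(n)`) AND some frozen weak-coupling Wilson scheme for `SU(2)` carries OS data `T` with
`IsYangMillsFor ∧ IsNontrivial ∧ IsNonGaussian`.  Intended inhabitant (physics; NOT constructible in the tree): take `β_k`
above the envelope, renormalise the curvature by `c_k ∝ β_k a_k⁻⁴` and every other species by `0`; at each FIXED lattice the
`β → ∞` law of the rescaled plaquette field is the lattice-Maxwell curvature Gaussian (plus torons on the torus), and as
`a_k → 0` the renormalised curvature strings converge to the WICK SQUARE `:F²:` of `dim SU(2) = 3` free Maxwell fields —
OS data that pass the typed `IsNontrivial` and `IsNonGaussian` (`OSData.IsNonGaussian`'s docstring: "the Wick square of a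
free field passes it").  Missing to construct it: (i) the finite-lattice semiclassical limit of Wilson's `SU(2)` measure on
a torus including the toron zero modes, (ii) the free-Maxwell Wick square as `OSData` (E0′–E4); cf. the sibling hypothesis
`GaplessWeakCouplingLimit` (p119136, asymptotic-freedom regime, needs in addition correlation LOWER bounds), which this
`H` sharpens: no lower bound on correlations is needed, only the growth rate of `β_k`.

Class if `H` is ever inhabited: refuted-MISSTATED — the witness exploits the universal quantifier over `(r, sch, T)`; the
repaired statement is the existential C′ recorded in `CrossoverCertificateFalseOfGaplessWeakCouplingLimit.lean` (choose the
confining-regime scheme).  CONTRAPOSITIVE (for planners): any proof of the crux AS TYPED must derive, from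
`IsYangMillsFor ∧ IsNontrivial ∧ IsNonGaussian` alone, that `β_k < frozenEnvelope ⌈k/a_k⌉` frequently — an upper bound on the
bare coupling's decay in terms of the lattice spacing.
-/

noncomputable section

namespace Summit.QuantumFields.YangMills.Theorems.CrossoverCertificate.Negative

open Filter Topology Finset
open Literature.MathematicalPhysics.QuantumLattice Literature.MathematicalPhysics.QuantumFieldTheory
open Summit.QuantumFields.YangMills.Cruxes.CrossoverCertificate.Birth

/-- **The freezing threshold** of the cell geometry `(b, n)`: the infimum of the non-negative `β₀` beyond which the
one-cube influence of `SU(2)` Wilson theory (fundamental representation) is at least `1/2` for every `β ≥ β₀`.  For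
`b ≥ 2`, `n ≥ 1` the set is non-empty (`exists_beta0_half_le_influence`) and bounded below by `0`, so the infimum is
attained up to any slack (`half_le_influence_of_frozenThreshold_lt`); for other `(b, n)` it is the harmless junk value
`sInf` of a possibly empty set (`= 0`), never used. [folklore] -/
def frozenThreshold (b n : ℕ) : ℝ :=
  sInf {β₀ : ℝ | 0 ≤ β₀ ∧ ∀ β : ℝ, β₀ ≤ β →
    (1 / 2 : ℝ) ≤ influence (G := Matrix.specialUnitaryGroup (Fin 2) ℂ) (fundamentalRep (Fin 2)) β b n}

/-- **The freezing envelope**: `frozenEnvelope m = 1 + ∑_{b ≤ m} ∑_{n ≤ m} frozenThreshold b n`, a threshold that serves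
every cell geometry `(b, n)` with `b, n ≤ m` at once (all summands are `≥ 0`). [folklore] -/
def frozenEnvelope (m : ℕ) : ℝ :=
  1 + ∑ b ∈ Finset.range (m + 1), ∑ n ∈ Finset.range (m + 1), frozenThreshold b n

/-- The threshold set is non-empty for `b ≥ 2`, `n ≥ 1` (frozen-coupling theorem) and consists of non-negative reals.
[folklore] -/
theorem frozenThreshold_set_nonempty {b n : ℕ} (hb : 2 ≤ b) (hn : 1 ≤ n) :
    {β₀ : ℝ | 0 ≤ β₀ ∧ ∀ β : ℝ, β₀ ≤ β →
      (1 / 2 : ℝ) ≤ influence (G := Matrix.specialUnitaryGroup (Fin 2) ℂ) (fundamentalRep (Fin 2)) β b n}.Nonempty := by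
  obtain ⟨β₀, hβ₀⟩ := exists_beta0_half_le_influence b n hb hn
  exact ⟨max 0 β₀, le_max_left _ _, fun β hβ => hβ₀ β (le_trans (le_max_right _ _) hβ)⟩

/-- `0 ≤ frozenThreshold b n` (an infimum of non-negative reals, or the junk value `0`). [folklore] -/
theorem frozenThreshold_nonneg (b n : ℕ) : 0 ≤ frozenThreshold b n := by
  unfold frozenThreshold
  by_cases h : {β₀ : ℝ | 0 ≤ β₀ ∧ ∀ β : ℝ, β₀ ≤ β →
      (1 / 2 : ℝ) ≤ influence (G := Matrix.specialUnitaryGroup (Fin 2) ℂ) (fundamentalRep (Fin 2)) β b n}.Nonempty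
  · exact le_csInf h fun x hx => hx.1
  · rw [Set.not_nonempty_iff_eq_empty.1 h, Real.sInf_empty]

/-- **Beyond the threshold the influence is `≥ 1/2`**: for `b ≥ 2`, `n ≥ 1` and `β > frozenThreshold b n`. [folklore] -/
theorem half_le_influence_of_frozenThreshold_lt {b n : ℕ} (hb : 2 ≤ b) (hn : 1 ≤ n) {β : ℝ}
    (hβ : frozenThreshold b n < β) :
    (1 / 2 : ℝ) ≤ influence (G := Matrix.specialUnitaryGroup (Fin 2) ℂ) (fundamentalRep (Fin 2)) β b n := by
  have hne := frozenThreshold_set_nonempty hb hn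
  have hbdd : BddBelow {β₀ : ℝ | 0 ≤ β₀ ∧ ∀ β : ℝ, β₀ ≤ β →
      (1 / 2 : ℝ) ≤ influence (G := Matrix.specialUnitaryGroup (Fin 2) ℂ) (fundamentalRep (Fin 2)) β b n} :=
    ⟨0, fun x hx => hx.1⟩
  obtain ⟨β₀, hβ₀, hlt⟩ := (csInf_lt_iff hbdd hne).1 hβ
  exact hβ₀.2 β hlt.le

/-- **The envelope serves all small geometries**: `2 ≤ b ≤ m`, `1 ≤ n ≤ m`, `frozenEnvelope m ≤ β` imply
`Θ(ρ, β, b, n) ≥ 1/2`. [folklore] -/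
theorem half_le_influence_of_frozenEnvelope_le {m b n : ℕ} (hb : 2 ≤ b) (hbm : b ≤ m) (hn : 1 ≤ n) (hnm : n ≤ m) {β : ℝ}
    (hβ : frozenEnvelope m ≤ β) :
    (1 / 2 : ℝ) ≤ influence (G := Matrix.specialUnitaryGroup (Fin 2) ℂ) (fundamentalRep (Fin 2)) β b n := by
  refine half_le_influence_of_frozenThreshold_lt hb hn (lt_of_lt_of_le ?_ hβ)
  unfold frozenEnvelope
  have h1 : frozenThreshold b n ≤ ∑ n' ∈ Finset.range (m + 1), frozenThreshold b n' :=
    Finset.single_le_sum (f := fun n' => frozenThreshold b n') (fun n' _ => frozenThreshold_nonneg b n')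
      (Finset.mem_range.2 (by omega))
  have h2 : ∑ n' ∈ Finset.range (m + 1), frozenThreshold b n' ≤
      ∑ b' ∈ Finset.range (m + 1), ∑ n' ∈ Finset.range (m + 1), frozenThreshold b' n' :=
    Finset.single_le_sum (f := fun b' => ∑ n' ∈ Finset.range (m + 1), frozenThreshold b' n')
      (fun b' _ => Finset.sum_nonneg fun n' _ => frozenThreshold_nonneg b' n') (Finset.mem_range.2 (by omega))
  linarith

/-- **H — `FrozenSU2Limit`: a frozen weak-coupling Wilson scheme for `SU(2)` with a non-trivial non-Gaussian
Yang–Mills-labelled limit.**  `SU(2)` is an admissible gauge group (`IsCompactSimpleLieGroup`), and there are a sequential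
Wilson scheme `sch` and OS data `T` with `β_k → ∞`, `IsYangMillsFor r sch T` for the fundamental lattice representation `r`,
`T.IsNontrivial r.curvature`, `T.IsNonGaussian r.curvature`, along which the inverse bare coupling dominates the freezing
envelope of the lattice sizes in play: `β_k ≥ frozenEnvelope ⌈k / a_k⌉` for all large `k`.  Intended inhabitant: `β_k`
above the envelope, curvature renormalised by `β_k a_k⁻⁴`, all other species by `0`; limit = the Wick square of three free
Maxwell fields (massless, yet `IsNontrivial` and `IsNonGaussian` as typed).  Not constructible in the tree today (finite-lattice
`β → ∞` semiclassics of Wilson's measure on tori with torons; free-Maxwell Wick square as `OSData`); this is the hypothesis of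
the negative lemma `crossoverCertificate_false_of_frozenSU2Limit`, deliberately with no `_holds`.  Sources for the intended
inhabitant: Jaffe–Witten (2000) §1, §6 (asymptotic freedom, continuum limit of the lattice regularisation); Bałaban (1988)
(ultraviolet stability, the nearest theorem); Lüscher (1983) (torons on the torus). -/
@[conjecture] def FrozenSU2Limit : Prop :=
  IsCompactSimpleLieGroup (Matrix.specialUnitaryGroup (Fin 2) ℂ) ∧
  ∃ (sch : SpeciesScheme (YMSpecies (Matrix.specialUnitaryGroup (Fin 2) ℂ)))
    (T : OSData (YMSpecies (Matrix.specialUnitaryGroup (Fin 2) ℂ)) 4),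
    sch.HasWeakCouplingLimit ∧
    IsYangMillsFor (⟨2, fundamentalRep (Fin 2), continuous_fundamentalRep (Fin 2), fundamentalRep_injective (Fin 2),
      fundamentalRep_mem_unitaryGroup⟩ : LatticeRep (Matrix.specialUnitaryGroup (Fin 2) ℂ)) sch T ∧
    T.IsNontrivial (LatticeRep.curvature ⟨2, fundamentalRep (Fin 2), continuous_fundamentalRep (Fin 2),
      fundamentalRep_injective (Fin 2), fundamentalRep_mem_unitaryGroup⟩) ∧
    T.IsNonGaussian (LatticeRep.curvature ⟨2, fundamentalRep (Fin 2), continuous_fundamentalRep (Fin 2),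
      fundamentalRep_injective (Fin 2), fundamentalRep_mem_unitaryGroup⟩) ∧
    ∀ᶠ k : ℕ in atTop, frozenEnvelope ⌈(k : ℝ) / sch.a k⌉₊ ≤ sch.β k

/-- **Along a frozen scheme the one-cube influence stays `≥ 1/2` at EVERY physical scale.** If
`β_k ≥ frozenEnvelope ⌈k/a_k⌉` eventually, then for every `ℓ > 0`, `n ≥ 1`: `Θ(ρ, β_k, ⌈ℓ/a_k⌉, n) ≥ 1/2` eventually.
[folklore] -/
theorem eventually_half_le_influence_of_isFrozen (sch : SpeciesScheme (YMSpecies (Matrix.specialUnitaryGroup (Fin 2) ℂ)))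
    (hfrozen : ∀ᶠ k : ℕ in atTop, frozenEnvelope ⌈(k : ℝ) / sch.a k⌉₊ ≤ sch.β k) {ℓ : ℝ} (hℓ : 0 < ℓ) {n : ℕ} (hn : 1 ≤ n) :
    ∀ᶠ k : ℕ in atTop,
      (1 / 2 : ℝ) ≤ influence (G := Matrix.specialUnitaryGroup (Fin 2) ℂ) (fundamentalRep (Fin 2)) (sch.β k) ⌈ℓ / sch.a k⌉₊ n := by
  have hb : ∀ᶠ k : ℕ in atTop, 2 ≤ ⌈ℓ / sch.a k⌉₊ := (tendsto_ceil_div_a sch hℓ).eventually (eventually_ge_atTop 2)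
  have hk : ∀ᶠ k : ℕ in atTop, max (⌈ℓ⌉₊) n ≤ k := eventually_ge_atTop _
  have ha : ∀ᶠ k : ℕ in atTop, sch.a k ≤ 1 := sch.tendsto_a.eventually (eventually_le_nhds one_pos)
  filter_upwards [hfrozen, hb, hk, ha] with k hfk hbk hkk hak
  have hapos : 0 < sch.a k := sch.a_pos k
  have hℓk : ℓ ≤ k := le_trans (Nat.le_ceil ℓ) (by exact_mod_cast le_trans (le_max_left _ _) hkk)
  have hnk : n ≤ k := le_trans (le_max_right _ _) hkk
  -- b = ⌈ℓ/a_k⌉ ≤ m = ⌈k/a_k⌉ and n ≤ k ≤ m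
  have hbm : ⌈ℓ / sch.a k⌉₊ ≤ ⌈(k : ℝ) / sch.a k⌉₊ := Nat.ceil_mono (div_le_div_of_nonneg_right hℓk hapos.le)
  have hkm : k ≤ ⌈(k : ℝ) / sch.a k⌉₊ := by
    have : (k : ℝ) ≤ (k : ℝ) / sch.a k := by
      rw [le_div_iff₀ hapos]; nlinarith [Nat.cast_nonneg (α := ℝ) k]
    exact_mod_cast le_trans this (Nat.le_ceil _)
  exact half_le_influence_of_frozenEnvelope_le hbk hbm hn (le_trans hnk hkm) hfk

/-- The shell count `M(n) = (4n+3)⁴ − (4n+1)⁴` is at least `2` (indeed `≥ 1776`) for every `n`. [folklore] -/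
theorem two_le_shellCount : ∀ n : ℕ, (2 : ℝ) ≤ ((((4 * n + 3) ^ 4 - (4 * n + 1) ^ 4 : ℕ)) : ℝ) := by
  intro n
  have key : (4 * n + 3) ^ 4 =
      (4 * n + 1) ^ 4 + (8 * (4 * n + 1) ^ 3 + 24 * (4 * n + 1) ^ 2 + 32 * (4 * n + 1) + 16) := by ring
  have : (2 : ℕ) ≤ (4 * n + 3) ^ 4 - (4 * n + 1) ^ 4 := by rw [key]; omega
  exact_mod_cast this

/-- **`¬ CrossoverCertificate` modulo `FrozenSU2Limit`.** If some frozen weak-coupling Wilson scheme for `SU(2)` has a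
non-trivial non-Gaussian Yang–Mills-labelled limit, the crux AS TYPED (∀ over `(G, r, sch, T)`) is false: its certificate
would give `Θ(ρ, β_k, ⌈ℓ/a_k⌉, n) ≤ ε < 1/M(n) ≤ 1/2` eventually at some scale, while the frozen-coupling theorem gives
`Θ ≥ 1/2` eventually at every scale.  Composing with an inhabitant of `H` is the real refutation (class refuted-misstated;
repair: make the crux existential in the scheme). [folklore] -/
theorem crossoverCertificate_false_of_frozenSU2Limit :
    FrozenSU2Limit → ¬ Summit.QuantumFields.YangMills.Theses.OneCertifiedCube.CrossoverCertificate := by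
  rintro ⟨hG, sch, T, hW, hYM, hNT, hNG, hfrozen⟩ hC
  obtain ⟨ℓ, hℓ, n, ε, hn, -, hM, hev⟩ := (crossoverCertificate_iff.1 hC) (Matrix.specialUnitaryGroup (Fin 2) ℂ) hG
    ⟨2, fundamentalRep (Fin 2), continuous_fundamentalRep (Fin 2), fundamentalRep_injective (Fin 2),
      fundamentalRep_mem_unitaryGroup⟩ sch T hW hYM hNT hNG
  -- ε < 1/2 since ε · M(n) < 1 and M(n) ≥ 2
  have hε : ε < 1 / 2 := by
    have h2 := two_le_shellCount n
    by_contra hge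
    push Not at hge
    have : (1 : ℝ) ≤ ε * ((((4 * n + 3) ^ 4 - (4 * n + 1) ^ 4 : ℕ)) : ℝ) := by nlinarith
    linarith
  have hfr := eventually_half_le_influence_of_isFrozen sch hfrozen hℓ hn
  obtain ⟨k, hk1, hk2⟩ := (hfr.and hev).exists
  exact absurd (le_trans hk1 hk2) (not_le.2 hε)

end Summit.QuantumFields.YangMills.Theorems.CrossoverCertificate.Negative

end
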